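import Summits.HubbardSuperconductivity.HubbardSuperconductivity.Theorems.KLProgrammeKLRegimeTwoVolumeReadoutZeroFrame
import Summits.HubbardSuperconductivity.HubbardSuperconductivity.Theorems.KLProgrammeKLRegimeSplitSlotsV17F
import Literature.Probability.LatticeModels.SubmultiplicativeTreeWeight

/-!
# The two-volume read-out of the local part AT SCALE `0` IN THE ENGINE'S CURRENCY (scheme F, `K₀ = 0`)

The nested spatial leg of (E3f-F) at scale `0` compares `klLocalPart L₁ M β U μ (klFlowFrameU L₁ M β U μ 0) 0 θ` with the same reading
in the volume `L₂`, `L₁ ∣ L₂`, common cutoff `M`.  Since `klFlowFrameU … 0 = 0` (`klFlowFrameU_zero`), the bare-frame door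
`abs_klLocalPart_sub_le_of_copiesStep_zeroFrame` applies.  This file re-keys that door to the objects the scale-`0` engine works with:

* the grid `N = 2·(2·M)` of `isGramBoundedR_scaleZero_of_frameOK_sharp` / `klEffectiveAction_zero_eq_map_hubbardGridSub`,
* the grid covariance `S_Lᵀ · hubbardCovAboveCT L M β μ 0 0 klE0 · S_L` (`S_L = hubbardGridSub L M β (2·(2·M))`) and the grid
  interaction `hubbardGridInteraction L (2·(2·M)) β U` (no counterterm at `K₀ = 0`),
* the GRID partition function (the native `IsUnit` output of the single-scale step) instead of the field one,
* the `(1 + diam)`-weighted pinned degree-`2` profile of the FINE action (the `Nw 1` datum of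
  `hubbardGrid_sum_norm_kernel_sub_le`, at the fine volume) in place of the first spatial moment `M₂(w)`,
* an EXPLICIT deepest pin `w₀ = (0, (r₀, r₀))`, `r₀ = (L₁ − 1)/2`, whose residues are discharged here,
* `L₁ ∣ L₂` in place of `L₂ = b·L₁`.

What remains for the (E3f-F)₀ spatial leg after this file: the block-step bound `B` (k3c4-p1's `hubbardGrid_sum_norm_kernel_sub_le` at
`n = 1`, `p = 0`, `ν = 0`, pin `((w₀, ↑), +)`, from one-volume decay / Gram / profile data), the fine profile number `Nw₁`, the grid
partition functions at both volumes, and the rate inequality against `Q.CL β 0 / 4 / L₁`.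
-/

namespace Summit.HubbardSuperconductivity.HubbardSuperconductivity.Theorems.TwoVolumeDefect

open Finset Literature.MathematicalPhysics.QuantumLattice GrassmannAlgebra Literature.Probability.LatticeModels BattleFederbush
open Summit.HubbardSuperconductivity.HubbardSuperconductivity.Theorems.KLProgrammeLegKernels
open Summit.HubbardSuperconductivity.HubbardSuperconductivity.Theorems.KLRegimeSplit
open Summit.HubbardSuperconductivity.HubbardSuperconductivity.Theorems.EngineV8

/-! ## §1 The first spatial moment of the pinned two-point kernel is dominated by the weighted degree-`2` profile -/

section Profile

variable {Lf N : ℕ} [NeZero Lf]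

/-- **`M₂(w) ≤ Nw₁`**: the first spatial moment `Σ_{p₁′} tnorm(p₁′ − w)·‖W₂((w,↑,+),(p₁′,↑,−))‖` of the pinned degree-`2` kernel is at most
the `(1 + diam)`-weighted pinned degree-`2` profile `Σ_{Y : Y 0 = (w,↑,+)} ‖W₂(Y)‖·(1 + diam Y)` (the torus distance of the two legs is
at most the diameter of the label set, and the map `p₁′ ↦ ((w,↑,+),(p₁′,↑,−))` is injective into the pinned families). -/
theorem sum_tnorm_mul_norm_kernel_two_le_of_weightedProfile (W : GrassmannAlgebra ℂ (GridLeg (GridPoint Lf N))) (w : GridPoint Lf N)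
    {Nw₁ : ℝ}
    (hNw : ∑ Y ∈ univ.filter (fun Y : Fin 2 → GridLeg (GridPoint Lf N) => Y 0 = ((w, 0), 0)),
      ‖kernel ℂ W 2 Y‖ * (1 + labelDiam (fun Y₁ Y₂ : GridLeg (GridPoint Lf N) => (Torus.tnorm (Y₁.1.1.2 - Y₂.1.1.2) : ℝ)) (univ.image Y)) ≤
        Nw₁) :
    ∑ p₁' : GridPoint Lf N, (Torus.tnorm (p₁'.2 - w.2) : ℝ) * ‖kernel ℂ W 2 (fun i => ((![w, p₁'] i, 0), i))‖ ≤ Nw₁ := by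
  classical
  set d : GridLeg (GridPoint Lf N) → GridLeg (GridPoint Lf N) → ℝ := fun Y₁ Y₂ => (Torus.tnorm (Y₁.1.1.2 - Y₂.1.1.2) : ℝ) with hd
  set emb : GridPoint Lf N → (Fin 2 → GridLeg (GridPoint Lf N)) := fun p i => ((![w, p] i, 0), i) with hemb
  have hemb_inj : Function.Injective emb := by
    intro p q h
    have h1 := congr_fun h 1
    simp only [hemb, Matrix.cons_val_one, Prod.mk.injEq] at h1
    exact h1.1.1
  have hemb0 : ∀ p, emb p 0 = ((w, 0), 0) := fun p => by simp [hemb]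
  have hemb1 : ∀ p, emb p 1 = ((p, 0), 1) := fun p => by simp [hemb]
  -- termwise: tnorm ≤ 1 + diam
  have hterm : ∀ p : GridPoint Lf N, (Torus.tnorm (p.2 - w.2) : ℝ) * ‖kernel ℂ W 2 (emb p)‖ ≤
      ‖kernel ℂ W 2 (emb p)‖ * (1 + labelDiam d (univ.image (emb p))) := by
    intro p
    rw [mul_comm]
    refine mul_le_mul_of_nonneg_left ?_ (norm_nonneg _)
    have h1 : emb p 1 ∈ univ.image (emb p) := mem_image_of_mem _ (mem_univ _)
    have h0 : emb p 0 ∈ univ.image (emb p) := mem_image_of_mem _ (mem_univ _)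
    have hle := le_labelDiam d h1 h0
    rw [hemb1, hemb0] at hle
    have hnn := labelDiam_nonneg d (univ.image (emb p))
    change (Torus.tnorm (p.2 - w.2) : ℝ) ≤ labelDiam d (univ.image (emb p)) at hle
    linarith
  calc ∑ p₁' : GridPoint Lf N, (Torus.tnorm (p₁'.2 - w.2) : ℝ) * ‖kernel ℂ W 2 (emb p₁')‖
      ≤ ∑ p₁' : GridPoint Lf N, ‖kernel ℂ W 2 (emb p₁')‖ * (1 + labelDiam d (univ.image (emb p₁'))) := sum_le_sum fun p _ => hterm p
    _ = ∑ Y ∈ univ.image emb, ‖kernel ℂ W 2 Y‖ * (1 + labelDiam d (univ.image Y)) := by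
        rw [sum_image fun p _ q _ h => hemb_inj h]
    _ ≤ ∑ Y ∈ univ.filter (fun Y : Fin 2 → GridLeg (GridPoint Lf N) => Y 0 = ((w, 0), 0)),
          ‖kernel ℂ W 2 Y‖ * (1 + labelDiam d (univ.image Y)) := by
        refine sum_le_sum_of_subset_of_nonneg ?_ fun Y _ _ => mul_nonneg (norm_nonneg _) (by have := labelDiam_nonneg d (univ.image Y); linarith)
        intro Y hY
        obtain ⟨p, -, rfl⟩ := mem_image.1 hY
        exact mem_filter.2 ⟨mem_univ _, hemb0 p⟩
    _ ≤ Nw₁ := hNw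

end Profile

/-! ## §2 Grid ↔ field partition function at seed `0` -/

section Partition

variable {L M N : ℕ} [NeZero L]

/-- **The grid partition function IS the field partition function** (`4M ≤ N + 1`, `β ≠ 0`): `Z(S_Nᵀ C^K_{>Λ} S_N, V_N) = Z(normalCovariance (uvSymbolCT K Λ), V_U)`
— the grid substitution maps `V_N ↦ V_U` and `C^K_{>Λ}` at seed `0` is the normal covariance of `uvSymbolCT`. -/
theorem effPartitionFn_grid_eq_field {β : ℝ} (hβ : β ≠ 0) (U μ : ℝ) (K : TrigPolyC4v) (Λ : ℝ) (hN : 4 * M ≤ N + 1) [NeZero N] :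
    effPartitionFn ℂ ((hubbardGridSub L M β N).transpose * hubbardCovAboveCT L M β μ 0 K Λ * hubbardGridSub L M β N)
        (hubbardGridInteraction L N β U) =
      effPartitionFn ℂ (normalCovariance L M (uvSymbolCT L M β μ K Λ)) (hubbardInteraction L M β U) := by
  rw [← map_hubbardGridSub_gridInteraction hβ U hN, effPartitionFn_map, LinearMap.toMatrix'_toLin',
    hubbardCovAboveCT_zero_seed_eq_normalCovariance_uvSymbolCT]

/-- The `IsUnit` form consumed by the read-out doors. -/
theorem isUnit_effPartitionFn_field_of_grid {β : ℝ} (hβ : β ≠ 0) (U μ : ℝ) (K : TrigPolyC4v) (Λ : ℝ) (hN : 4 * M ≤ N + 1) [NeZero N]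
    (hZ : IsUnit (effPartitionFn ℂ ((hubbardGridSub L M β N).transpose * hubbardCovAboveCT L M β μ 0 K Λ * hubbardGridSub L M β N)
      (hubbardGridInteraction L N β U))) :
    IsUnit (effPartitionFn ℂ (normalCovariance L M (uvSymbolCT L M β μ K Λ)) (hubbardInteraction L M β U)) := by
  rwa [effPartitionFn_grid_eq_field hβ U μ K Λ hN] at hZ

end Partition

/-! ## §3 The scale-`0` nested spatial leg in the engine's currency -/

section ScaleZero

variable {L₁ L₂ M N : ℕ} [NeZero L₁] [NeZero L₂] [NeZero M]

/-- **THE BARE-FRAME TWO-VOLUME DOOR AT SCALE `0`, ENGINE CURRENCY, ANY DEEPEST-RESIDUE PIN** (grid `N` with `2M ≤ N`, `4M ≤ N + 1`):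
for `L₁ ∣ L₂`, `0 < β`, the grid partition functions units at both volumes, a fine pin `w` of residues `r₀ = (L₁−1)/2`, ANY bound `B` of
the pinned degree-`2` block-step defect (the `n = 1`, `p = 0`, `ν = 0` instance of `hubbardGrid_sum_norm_kernel_sub_le`'s left side) and
ANY bound `Nw₁` of the fine `(1 + diam)`-weighted pinned degree-`2` profile,
`|klLocalPart L₁ … (K₀ L₁) 0 θ − klLocalPart L₂ … (K₀ L₂) 0 θ| ≤ (2N/|β|)·B + 2·((2N/|β|)·Nw₁/((L₁−1)/2+1))`. -/
theorem abs_klLocalPart_flowFrame_zero_sub_le_of_pin (hdvd : L₁ ∣ L₂) {β : ℝ} (hβ : 0 < β) (hN : 2 * M ≤ N) (hN4 : 4 * M ≤ N + 1)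
    [NeZero N] (U μ : ℝ) (w : GridPoint L₂ N) (hwres : ∀ i, (w.2 i).val % L₁ = (L₁ - 1) / 2)
    (hZc : IsUnit (effPartitionFn ℂ ((hubbardGridSub L₁ M β N).transpose * hubbardCovAboveCT L₁ M β μ 0 0 klE0 * hubbardGridSub L₁ M β N)
      (hubbardGridInteraction L₁ N β U)))
    (hZf : IsUnit (effPartitionFn ℂ ((hubbardGridSub L₂ M β N).transpose * hubbardCovAboveCT L₂ M β μ 0 0 klE0 * hubbardGridSub L₂ M β N)
      (hubbardGridInteraction L₂ N β U)))
    {B Nw₁ : ℝ}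
    (hstep : ∑ X ∈ univ.filter (fun X : Fin 2 → GridLeg (GridPoint L₂ N) => X 0 = ((w, 0), 0)),
      ‖kernel ℂ (effAction ℂ ((hubbardGridSub L₂ M β N).transpose * hubbardCovAboveCT L₂ M β μ 0 0 klE0 * hubbardGridSub L₂ M β N)
            (hubbardGridInteraction L₂ N β U)) 2 X -
        (if ∀ i j, ((X i).1.1.2 j).val / L₁ = ((X 0).1.1.2 j).val / L₁ then
          kernel ℂ (effAction ℂ ((hubbardGridSub L₁ M β N).transpose * hubbardCovAboveCT L₁ M β μ 0 0 klE0 * hubbardGridSub L₁ M β N)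
              (hubbardGridInteraction L₁ N β U)) 2
            (fun i => ((((X i).1.1.1, fun j => ((((X i).1.1.2 j).val : ℕ) : ZMod L₁)), (X i).1.2), (X i).2)) else 0)‖ ≤ B)
    (hNw : ∑ Y ∈ univ.filter (fun Y : Fin 2 → GridLeg (GridPoint L₂ N) => Y 0 = ((w, 0), 0)),
      ‖kernel ℂ (effAction ℂ ((hubbardGridSub L₂ M β N).transpose * hubbardCovAboveCT L₂ M β μ 0 0 klE0 * hubbardGridSub L₂ M β N)
            (hubbardGridInteraction L₂ N β U)) 2 Y‖ *
        (1 + labelDiam (fun Y₁ Y₂ : GridLeg (GridPoint L₂ N) => (Torus.tnorm (Y₁.1.1.2 - Y₂.1.1.2) : ℝ)) (univ.image Y)) ≤ Nw₁)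
    (θ : ℝ) :
    |klLocalPart L₁ M β U μ (klFlowFrameU L₁ M β U μ 0) 0 θ - klLocalPart L₂ M β U μ (klFlowFrameU L₂ M β U μ 0) 0 θ| ≤
      2 * N / |β| * B + 2 * (2 * N / |β| * Nw₁ / (((L₁ - 1) / 2 + 1 : ℕ) : ℝ)) := by
  obtain ⟨b, hb⟩ := hdvd
  have hL : L₂ = b * L₁ := by rw [hb, mul_comm]
  have e0 : klScale klE0 0 = klE0 := by simp [klScale]
  have hcov : ∀ (L : ℕ) [NeZero L], hubbardCovAboveCT L M β μ 0 0 klE0 = normalCovariance L M (uvSymbolCT L M β μ 0 (klScale klE0 0)) := by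
    intro L _; rw [hubbardCovAboveCT_zero_seed_eq_normalCovariance_uvSymbolCT, e0]
  rw [hcov L₁] at hZc hstep
  rw [hcov L₂] at hZf hstep hNw
  have hZc' := isUnit_effPartitionFn_field_of_grid (L := L₁) hβ.ne' U μ 0 (klScale klE0 0) hN4
    (by rwa [hubbardCovAboveCT_zero_seed_eq_normalCovariance_uvSymbolCT])
  have hZf' := isUnit_effPartitionFn_field_of_grid (L := L₂) hβ.ne' U μ 0 (klScale klE0 0) hN4
    (by rwa [hubbardCovAboveCT_zero_seed_eq_normalCovariance_uvSymbolCT])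
  have key := abs_klLocalPart_sub_le_of_copiesStep_zeroFrame hL hβ hN hN4 U μ 0 w hZc' hZf' hwres hstep θ
  have hM₂ := sum_tnorm_mul_norm_kernel_two_le_of_weightedProfile _ w hNw
  simp only [klFlowFrameU_zero]
  refine key.trans ?_
  have hT : (0 : ℝ) < (((L₁ - 1) / 2 + 1 : ℕ) : ℝ) := by positivity
  have hc : (0 : ℝ) ≤ 2 * N / |β| := by positivity
  gcongr

/-- **THE SAME WITH THE PIN CHOSEN**: grid `N = 2·(2·M)` (the engine's), pin `w₀ = (0, (r₀, r₀))`, `r₀ = (L₁−1)/2` — its residues mod `L₁`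
are `r₀` because `r₀ < L₁ ≤ L₂`.  This is the scale-`0` nested spatial leg of (E3f-F) modulo the four one-volume numbers `B`, `Nw₁`
and the two grid partition functions. -/
theorem abs_klLocalPart_flowFrame_zero_sub_le (hdvd : L₁ ∣ L₂) {β : ℝ} (hβ : 0 < β) (U μ : ℝ)
    (hZc : IsUnit (effPartitionFn ℂ ((hubbardGridSub L₁ M β (2 * (2 * M))).transpose * hubbardCovAboveCT L₁ M β μ 0 0 klE0 *
      hubbardGridSub L₁ M β (2 * (2 * M))) (hubbardGridInteraction L₁ (2 * (2 * M)) β U)))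
    (hZf : IsUnit (effPartitionFn ℂ ((hubbardGridSub L₂ M β (2 * (2 * M))).transpose * hubbardCovAboveCT L₂ M β μ 0 0 klE0 *
      hubbardGridSub L₂ M β (2 * (2 * M))) (hubbardGridInteraction L₂ (2 * (2 * M)) β U)))
    {B Nw₁ : ℝ}
    (hstep : ∑ X ∈ univ.filter (fun X : Fin 2 → GridLeg (GridPoint L₂ (2 * (2 * M))) =>
        X 0 = ((((0 : Fin (2 * (2 * M))), fun _ => (((L₁ - 1) / 2 : ℕ) : ZMod L₂)), 0), 0)),
      ‖kernel ℂ (effAction ℂ ((hubbardGridSub L₂ M β (2 * (2 * M))).transpose * hubbardCovAboveCT L₂ M β μ 0 0 klE0 *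
            hubbardGridSub L₂ M β (2 * (2 * M))) (hubbardGridInteraction L₂ (2 * (2 * M)) β U)) 2 X -
        (if ∀ i j, ((X i).1.1.2 j).val / L₁ = ((X 0).1.1.2 j).val / L₁ then
          kernel ℂ (effAction ℂ ((hubbardGridSub L₁ M β (2 * (2 * M))).transpose * hubbardCovAboveCT L₁ M β μ 0 0 klE0 *
              hubbardGridSub L₁ M β (2 * (2 * M))) (hubbardGridInteraction L₁ (2 * (2 * M)) β U)) 2
            (fun i => ((((X i).1.1.1, fun j => ((((X i).1.1.2 j).val : ℕ) : ZMod L₁)), (X i).1.2), (X i).2)) else 0)‖ ≤ B)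
    (hNw : ∑ Y ∈ univ.filter (fun Y : Fin 2 → GridLeg (GridPoint L₂ (2 * (2 * M))) =>
        Y 0 = ((((0 : Fin (2 * (2 * M))), fun _ => (((L₁ - 1) / 2 : ℕ) : ZMod L₂)), 0), 0)),
      ‖kernel ℂ (effAction ℂ ((hubbardGridSub L₂ M β (2 * (2 * M))).transpose * hubbardCovAboveCT L₂ M β μ 0 0 klE0 *
            hubbardGridSub L₂ M β (2 * (2 * M))) (hubbardGridInteraction L₂ (2 * (2 * M)) β U)) 2 Y‖ *
        (1 + labelDiam (fun Y₁ Y₂ : GridLeg (GridPoint L₂ (2 * (2 * M))) => (Torus.tnorm (Y₁.1.1.2 - Y₂.1.1.2) : ℝ)) (univ.image Y)) ≤ Nw₁)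
    (θ : ℝ) :
    |klLocalPart L₁ M β U μ (klFlowFrameU L₁ M β U μ 0) 0 θ - klLocalPart L₂ M β U μ (klFlowFrameU L₂ M β U μ 0) 0 θ| ≤
      2 * ((2 * (2 * M) : ℕ) : ℝ) / |β| * B + 2 * (2 * ((2 * (2 * M) : ℕ) : ℝ) / |β| * Nw₁ / (((L₁ - 1) / 2 + 1 : ℕ) : ℝ)) := by
  have hL₁₂ : L₁ ≤ L₂ := by
    obtain ⟨b, hb⟩ := hdvd
    have hb0 : b ≠ 0 := by rintro rfl; exact NeZero.ne L₂ (by rw [hb, mul_zero])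
    rw [hb]; exact Nat.le_mul_of_pos_right _ (Nat.pos_of_ne_zero hb0)
  have hr : (L₁ - 1) / 2 < L₁ := by have := NeZero.pos L₁; omega
  have hwres : ∀ i : Fin 2, ((fun _ : Fin 2 => (((L₁ - 1) / 2 : ℕ) : ZMod L₂)) i).val % L₁ = (L₁ - 1) / 2 := by
    intro i
    simp only [ZMod.val_natCast]
    rw [Nat.mod_eq_of_lt (hr.trans_le hL₁₂), Nat.mod_eq_of_lt hr]
  exact abs_klLocalPart_flowFrame_zero_sub_le_of_pin hdvd hβ (by omega) (by omega) U μ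
    ((0 : Fin (2 * (2 * M))), fun _ => (((L₁ - 1) / 2 : ℕ) : ZMod L₂)) hwres hZc hZf hstep hNw θ

end ScaleZero

end Summit.HubbardSuperconductivity.HubbardSuperconductivity.Theorems.TwoVolumeDefect
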